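import Mathlib.Algebra.MvPolynomial.PDeriv
import Mathlib.Algebra.MvPolynomial.Monad
import Mathlib.Algebra.MvPolynomial.Degrees
import Mathlib.RingTheory.MvPolynomial.Basic
import HarnessLib

/-!
# Polynomial toolkit for Wooley's elimination: chain rule, degrees, constancy

Topic `Literature/NumberTheory/LFunctions` (toolkit for Wooley's theorem on simultaneous
congruences). Everything here is PROVED.

* `Wooley.pderiv_bind₁` — the chain rule `∂ₖ (f ∘ L) = ∑ᵢ (∂ᵢ f ∘ L) · ∂ₖ Lᵢ`.
* `Wooley.totalDegree_bind₁_le` — `deg (f ∘ L) ≤ deg f` when every `Lᵢ` has total degree `≤ 1`;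
  `Wooley.totalDegree_bind₁_le_mul` — `deg (f ∘ L) ≤ D · deg f` when every `deg Lᵢ ≤ D`.
* `Wooley.totalDegree_pderiv_lt` — `deg ∂ᵢ f < deg f` unless `∂ᵢ f = 0`.
* `Wooley.eq_C_of_pderiv_eq_zero` — in characteristic zero, a polynomial all of whose partial
  derivatives vanish is constant.

## References

* T. D. Wooley, *A note on simultaneous congruences*, J. Number Theory 58 (1996), 288–297, §2.
  [Wooley1996]
-/

noncomputable section

open MvPolynomial

namespace Literature.NumberTheory.LFunctions
namespace Wooley

variable {R : Type*} [CommRing R] {σ τ : Type*}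

/-- **Chain rule** for substitution into a multivariate polynomial:
`∂ₖ (bind₁ L f) = ∑ᵢ bind₁ L (∂ᵢ f) · ∂ₖ (L i)`. [folklore] -/
theorem pderiv_bind₁ [Fintype σ] [DecidableEq σ] [DecidableEq τ] (L : σ → MvPolynomial τ R)
    (f : MvPolynomial σ R) (k : τ) :
    pderiv k (bind₁ L f) = ∑ i, bind₁ L (pderiv i f) * pderiv k (L i) := by
  induction f using MvPolynomial.induction_on with
  | C a => simp
  | add p q hp hq =>
    simp only [map_add, hp, hq, add_mul, Finset.sum_add_distrib]
  | mul_X p n hp =>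
    have e : ∀ i, bind₁ L (pderiv i (p * X n)) = bind₁ L (pderiv i p) * L n
        + (if n = i then bind₁ L p else 0) := by
      intro i
      rw [(pderiv i).leibniz, smul_eq_mul, smul_eq_mul, map_add, map_mul, map_mul, bind₁_X_right,
        pderiv_X]
      simp only [Pi.single_apply]
      split_ifs <;> simp <;> ring
    have hR : ∑ i, bind₁ L (pderiv i (p * X n)) * pderiv k (L i)
        = (∑ i, bind₁ L (pderiv i p) * pderiv k (L i)) * L n + bind₁ L p * pderiv k (L n) := by
      simp_rw [e, add_mul, Finset.sum_add_distrib, ite_mul, zero_mul, Finset.sum_ite_eq,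
        Finset.mem_univ, if_true, Finset.sum_mul]
      congr 1
      exact Finset.sum_congr rfl fun i _ ↦ by ring
    rw [hR, map_mul, bind₁_X_right, (pderiv k).leibniz, smul_eq_mul, smul_eq_mul, hp]
    ring

/-- Total degree under substitution: if every `L i` has total degree `≤ D` then
`deg (bind₁ L f) ≤ D · deg f`. [folklore] -/
theorem totalDegree_bind₁_le_mul (L : σ → MvPolynomial τ R) (f : MvPolynomial σ R) {D : ℕ}
    (hL : ∀ i, (L i).totalDegree ≤ D) : (bind₁ L f).totalDegree ≤ D * f.totalDegree := by
  classical
  conv_lhs => rw [f.as_sum]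
  rw [map_sum]
  refine totalDegree_finsetSum_le fun m hm ↦ ?_
  rw [bind₁_monomial]
  refine (totalDegree_mul _ _).trans ?_
  rw [totalDegree_C, zero_add]
  refine (totalDegree_finsetProd _ _).trans ?_
  calc ∑ i ∈ m.support, (L i ^ m i).totalDegree
      ≤ ∑ i ∈ m.support, D * m i := Finset.sum_le_sum fun i _ ↦
          (totalDegree_pow _ _).trans (by rw [mul_comm D]; exact Nat.mul_le_mul_left _ (hL i))
    _ = D * ∑ i ∈ m.support, m i := by rw [Finset.mul_sum]
    _ ≤ D * f.totalDegree := Nat.mul_le_mul_left _ (le_totalDegree hm)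

/-- Total degree under a substitution by polynomials of degree `≤ 1` does not increase.
[folklore] -/
theorem totalDegree_bind₁_le (L : σ → MvPolynomial τ R) (f : MvPolynomial σ R)
    (hL : ∀ i, (L i).totalDegree ≤ 1) : (bind₁ L f).totalDegree ≤ f.totalDegree := by
  simpa using totalDegree_bind₁_le_mul L f hL

/-- The partial derivative lowers the total degree (when it is nonzero). [folklore] -/
theorem totalDegree_pderiv_lt [DecidableEq σ] {f : MvPolynomial σ R} {i : σ}
    (h : pderiv i f ≠ 0) : (pderiv i f).totalDegree < f.totalDegree := by
  rw [totalDegree, Finset.sup_lt_iff]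
  · intro m hm
    rw [mem_support_iff, coeff_pderiv] at hm
    have hc : coeff (m + Finsupp.single i 1) f ≠ 0 := fun h0 ↦ hm (by rw [h0, zero_mul])
    have hle := le_totalDegree (mem_support_iff.2 hc)
    have hsum : ((m + Finsupp.single i 1).sum fun _ e ↦ e) = (m.sum fun _ e ↦ e) + 1 := by
      rw [Finsupp.sum_add_index' (fun _ ↦ rfl) (fun _ _ _ ↦ rfl), Finsupp.sum_single_index rfl]
    change (m.sum fun _ e ↦ e) < f.totalDegree
    omega
  · -- `0 < f.totalDegree`: `f` is not constant since `∂ᵢ f ≠ 0`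
    rw [bot_eq_zero, pos_iff_ne_zero]
    intro h0
    rw [totalDegree_eq_zero_iff_eq_C] at h0
    apply h
    rw [h0, pderiv_C]

/-- In characteristic zero, a polynomial all of whose partial derivatives vanish is a constant.
[folklore] -/
theorem eq_C_of_pderiv_eq_zero [CharZero R] [IsDomain R] [DecidableEq σ] {f : MvPolynomial σ R}
    (h : ∀ i, pderiv i f = 0) : f = C (coeff 0 f) := by
  ext m
  rw [coeff_C]
  split_ifs with hm
  · rw [← hm]
  · -- `m ≠ 0`: pick `i` with `m i ≠ 0` and read the coefficient of `m - single i 1` in `∂ᵢ f = 0`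
    have hm' : m ≠ 0 := fun h' ↦ hm h'.symm
    obtain ⟨i, hi⟩ : ∃ i, m i ≠ 0 := by
      by_contra hall
      push Not at hall
      exact hm' (Finsupp.ext fun i ↦ by simpa using hall i)
    set m' : σ →₀ ℕ := m - Finsupp.single i 1 with hm'def
    have hmm : m' + Finsupp.single i 1 = m := by
      ext j
      simp only [hm'def, Finsupp.coe_add, Finsupp.coe_tsub, Pi.add_apply, Pi.sub_apply,
        Finsupp.single_apply]
      split_ifs with hij
      · subst hij; omega
      · omega
    have := congrArg (coeff m') (h i)
    rw [coeff_pderiv, coeff_zero, hmm] at this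
    rcases mul_eq_zero.1 this with h1 | h1
    · exact h1
    · exfalso
      have : (m' i : R) + 1 ≠ 0 := by
        have : ((m' i + 1 : ℕ) : R) ≠ 0 := Nat.cast_ne_zero.2 (Nat.succ_ne_zero _)
        exact_mod_cast this
      exact this h1

end Wooley
end Literature.NumberTheory.LFunctions
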